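import Literature.AnabelianGeometry.AbsoluteAnabelian.AbsTopII.TwoTripodNodalIndexDatum
import Literature.AnabelianGeometry.AbsoluteAnabelian.FreeProSigmaCyclicSubgroups
import HarnessLib

/-!
# [AbsTopII] Prop 1.3 (i), (iii), (iii′) at the index-`i` two-vertex datum: the inertia groups `I_{v_A}`, `I_{v_B}`, `I_e`

S. Mochizuki, *Topics in Absolute Anabelian Geometry II* [AbsTopII] (bib `MochizukiAbsTopII2013`; locators =
PDF pages of the kurims manuscript `paper:url-585b8d0ad0d9`), §1, Def 1.2 (ii) p. 10 and Prop 1.3 p. 11: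

> "(ii) If `e` is a node of `𝔾`, then we have a natural exact sequence `1 → Π_e → I_e → I → 1`; as abstract
> profinite groups, `I_e ≅ Ẑ^Σ × Ẑ^Σ`. […] (iii) […] we have a natural isomorphism `I_v ≅ I`; […] as abstract profinite
> groups, `I_v ≅ Ẑ^Σ`."

PROOF-ONLY companion (abc-iut-f-066 gen 8, row «TWO-VERTEX-Σ-INDEX-i») of `AbsTopII/TwoTripodNodalIndexDatum.lean`
(the index-`i` datum `M.dpscIdx`: `Π_H = P`, `Π_I = Π_I^{(i)} = Π_𝔾 · closure ⟨t₀^i⟩`, node `Σ`-index `i`).  The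
three inertia groups of the degenerating 4-pointed sphere at node index `i`, every `Σ`, `i` a `Σ`-integer:

* `Iv_zero_dpscIdx` (datum file) / ★ `Iv_one_dpscIdx`: **`I_{v_A} = closure ⟨t₀^i⟩`, `I_{v_B} = closure ⟨u₀^i⟩`**
  (`U ∩ Π_I^{(i)} = closure ⟨u₀^i⟩` since `u₀^i = w^{-i} t₀^i`, `Π_𝔾 · closure ⟨u₀^i⟩ = Π_I^{(i)}` and `U ∩ Π_𝔾 = 1`);
* ★ `IvNode_dpscIdx_eq`: **`I_e = Π_e · closure ⟨t₀^i⟩`** (`(Π_e·T) ∩ Π_I^{(i)}`, `T ∩ Π_𝔾 = 1`), an internal product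
  `Π_e × closure ⟨t₀^i⟩` of two closed free pro-`Σ`-cyclic groups — `closure ⟨t₀^i⟩ ≅ Ẑ^Σ` being the open subgroup
  of index `i` of `T ≅ Ẑ^Σ` (abc-iut's `IsFreeProSigmaCyclic.subgroup_of_isOpen` + `isOpen_closureZpowersPow`);
* ★ `prop13iii_dpscIdx`, `prop_1_3_iii'_dpscIdx`, `prop_1_3_i_dpscIdx` — **the typed Prop 1.3 (iii) (first clause,
  F-0275), (iii) rest (F-0299) and (i) (F-0297) HOLD at the index-`i` datum, NO hypothesis** (abc-iut-w5-d226 /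
  abc-iut-f-069 `ofEmbedding` bridges, fed with `I_v · Π_𝔾 = Π_I^{(i)}` and `I_v ≅ Ẑ^Σ` proved here);
* `prop_1_3_ii'_exact_dpscIdx`, `prop_1_3_ii'_product_dpscIdx` — the first two clauses of (ii′) (exact sequence
  `1 → Π_e → I_e → I → 1`; `I_e ≅ Ẑ^Σ × Ẑ^Σ`); the BRANCH clause with image index exactly `i` is
  `TwoTripodNodalIndexBranchPair.lean`.
HONEST FRAMING: classical profinite group theory at a constructed model (constructed ≠ geometric); nothing here bears on
[IUTchIII] Cor 3.12; no side taken; typed ≠ proved for print's statement about all stable log curves.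
-/

noncomputable section

open scoped Pointwise

namespace Literature.AnabelianGeometry.AbsoluteAnabelian.AbsTopII.TwoTripodNodal.Model

open Literature.AnabelianGeometry.SemiGraphs
open Literature.AnabelianGeometry.SemiGraphs.SemiGraphOfAnabelioids (IsProSigmaCompletion
  isFreeProSigmaCyclic_cuspInertia_closure)
open Literature.AnabelianGeometry.SemiGraphs.SemiGraphOfAnabelioids.IsProSigmaCompletion
open Literature.AnabelianGeometry.Anabelioids (IsSigmaInteger)
open Literature.GroupTheory.CombinatorialGroupTheory
open Literature.GroupTheory.CombinatorialGroupTheory.PuncturedSurfaceGroup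
open _root_.Topology

variable {Sigma : Set ℕ} (M : Model Sigma) (i : ℕ)

/-! ### `closure ⟨t₀^i⟩ ≅ Ẑ^Σ`: the open subgroup of index `i` of `T ≅ Ẑ^Σ` -/

/-- For a `Σ`-integer `i`, `closure ⟨t₀^i⟩` is OPEN of index `i` in `↥T` (procyclic structure of `T ≅ Ẑ^Σ`).
[cite: MochizukiAbsTopII2013, Prop 1.3 (iii) p.11] -/
theorem isOpen_TpowT (hi : IsSigmaInteger Sigma i) :
    IsOpen ((M.TpowT i : Subgroup ↥M.T) : Set ↥M.T) ∧ (M.TpowT i).index = i :=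
  isOpen_closureZpowersPow M.dense_zpowers_tT hi.1 ((M.isFreeProSigmaCyclic_T.isOpen_index_iff i).mpr hi)

/-- For a `Σ`-integer `i`, `closure ⟨u₀^i⟩` is OPEN of index `i` in `↥U`. [cite: MochizukiAbsTopII2013, Prop 1.3 (iii) p.11] -/
theorem isOpen_UpowU (hne : Sigma.Nonempty) (hprime : ∀ p ∈ Sigma, p.Prime) (hi : IsSigmaInteger Sigma i) :
    IsOpen ((M.UpowU i : Subgroup ↥M.U) : Set ↥M.U) ∧ (M.UpowU i).index = i :=
  isOpen_closureZpowersPow M.dense_zpowers_uU hi.1 (((M.isFreeProSigmaCyclic_U hne hprime).isOpen_index_iff i).mpr hi)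

/-- For a `Σ`-integer `i`, `closure ⟨w^i⟩` is OPEN of index `i` in `↥ι(Π_e)` (`Π_e ≅ Ẑ^Σ`, abc-iut-f-066 gen 5).
[cite: MochizukiAbsTopII2013, Prop 1.3 (ii) p.11] -/
theorem isOpen_WpowW (hi : IsSigmaInteger Sigma i) :
    IsOpen ((M.WpowW i : Subgroup ↥((M.nodeGp).map M.PiG.subtype)) : Set ↥((M.nodeGp).map M.PiG.subtype)) ∧
      (M.WpowW i).index = i :=
  isOpen_closureZpowersPow M.dense_zpowers_wW hi.1 ((M.isFreeProSigmaCyclic_W.isOpen_index_iff i).mpr hi)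

/-- **`closure ⟨t₀^i⟩ ≅ Ẑ^Σ`** for a `Σ`-integer `i` (an open subgroup of the free pro-`Σ`-cyclic `T`).
[cite: MochizukiAbsTopII2013, Prop 1.3 (iii) p.11] -/
theorem isFreeProSigmaCyclic_Tpow (hi : IsSigmaInteger Sigma i) : IsFreeProSigmaCyclic Sigma ↥(M.Tpow i) := by
  haveI : CompactSpace ↥M.T := isCompact_iff_compactSpace.mp (Subgroup.isClosed_topologicalClosure _).isCompact
  have h1 : IsFreeProSigmaCyclic Sigma ↥(M.TpowT i) := M.isFreeProSigmaCyclic_T.subgroup_of_isOpen _ (M.isOpen_TpowT i hi).1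
  obtain ⟨f, -⟩ := DPSCIndexData.exists_subgroupEquiv_ofEmbedding M.P M.T.subtype continuous_subtype_val
    Subtype.val_injective (K := M.TpowT i) (Subgroup.isClosed_of_isOpen _ (M.isOpen_TpowT i hi).1)
  have h2 := h1.of_continuousMulEquiv f
  rwa [TpowT_map_subtype] at h2

/-- **`closure ⟨u₀^i⟩ ≅ Ẑ^Σ`** for a `Σ`-integer `i`. [cite: MochizukiAbsTopII2013, Prop 1.3 (iii) p.11] -/
theorem isFreeProSigmaCyclic_Upow (hne : Sigma.Nonempty) (hprime : ∀ p ∈ Sigma, p.Prime) (hi : IsSigmaInteger Sigma i) :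
    IsFreeProSigmaCyclic Sigma ↥(M.Upow i) := by
  haveI : CompactSpace ↥M.U := isCompact_iff_compactSpace.mp (Subgroup.isClosed_topologicalClosure _).isCompact
  have h1 : IsFreeProSigmaCyclic Sigma ↥(M.UpowU i) :=
    (M.isFreeProSigmaCyclic_U hne hprime).subgroup_of_isOpen _ (M.isOpen_UpowU i hne hprime hi).1
  obtain ⟨f, -⟩ := DPSCIndexData.exists_subgroupEquiv_ofEmbedding M.P M.U.subtype continuous_subtype_val
    Subtype.val_injective (K := M.UpowU i) (Subgroup.isClosed_of_isOpen _ (M.isOpen_UpowU i hne hprime hi).1)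
  have h2 := h1.of_continuousMulEquiv f
  rwa [UpowU_map_subtype] at h2

/-! ### `u₀^i = w^{-i} t₀^i`; `U ∩ Π_I^{(i)} = closure ⟨u₀^i⟩` -/

/-- `w = ι(c₁c₂)` and `t₀` commute (the twist fixes the node element). [cite: MochizukiAbsTopII2013, Def 1.2 (ii) p.10] -/
theorem w_commute_t0 : Commute (M.ι (SemidirectProduct.inl (c 1 * c 2 : PuncturedSurfaceGroup 0 4)))
    (M.ι (SemidirectProduct.inr (Multiplicative.ofAdd (1 : ℤ)))) :=
  M.W_commute_T _ M.ι_node_mem_W _ M.t0_mem_T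

/-- `u₀ = w⁻¹ · t₀`. [cite: MochizukiAbsTopII2013, Def 1.2 (ii) p.10] -/
theorem u0_eq : M.ι (SemidirectProduct.inl (c 1 * c 2 : PuncturedSurfaceGroup 0 4)⁻¹ *
    SemidirectProduct.inr (Multiplicative.ofAdd (1 : ℤ))) =
    (M.ι (SemidirectProduct.inl (c 1 * c 2 : PuncturedSurfaceGroup 0 4)))⁻¹ *
      M.ι (SemidirectProduct.inr (Multiplicative.ofAdd (1 : ℤ))) := by
  rw [map_mul, map_inv, map_inv]

/-- **`u₀^i = w^{-i} · t₀^i`**. [cite: MochizukiAbsTopII2013, Def 1.2 (ii) p.10] -/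
theorem u0_pow_eq : M.ι (SemidirectProduct.inl (c 1 * c 2 : PuncturedSurfaceGroup 0 4)⁻¹ *
    SemidirectProduct.inr (Multiplicative.ofAdd (1 : ℤ))) ^ i =
    ((M.ι (SemidirectProduct.inl (c 1 * c 2 : PuncturedSurfaceGroup 0 4))) ^ i)⁻¹ *
      M.ι (SemidirectProduct.inr (Multiplicative.ofAdd (1 : ℤ))) ^ i := by
  rw [u0_eq, (M.w_commute_t0.inv_left).mul_pow, inv_pow]

/-- `t₀^i = w^i · u₀^i`. [cite: MochizukiAbsTopII2013, Def 1.2 (ii) p.10] -/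
theorem t0_pow_eq : M.ι (SemidirectProduct.inr (Multiplicative.ofAdd (1 : ℤ))) ^ i =
    (M.ι (SemidirectProduct.inl (c 1 * c 2 : PuncturedSurfaceGroup 0 4))) ^ i *
      M.ι (SemidirectProduct.inl (c 1 * c 2 : PuncturedSurfaceGroup 0 4)⁻¹ *
        SemidirectProduct.inr (Multiplicative.ofAdd (1 : ℤ))) ^ i := by
  rw [u0_pow_eq, mul_inv_cancel_left]

/-- `w^i ∈ Π_𝔾`. [cite: MochizukiAbsTopII2013, Def 1.2 (ii) p.10] -/
theorem w_pow_mem_PiG : (M.ι (SemidirectProduct.inl (c 1 * c 2 : PuncturedSurfaceGroup 0 4))) ^ i ∈ M.PiG :=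
  M.PiG.pow_mem (Subgroup.map_subtype_le _ M.ι_node_mem_W) i

/-- `u₀^i ∈ Π_I^{(i)}`. [cite: MochizukiAbsTopII2013, Def 1.2 (ii) p.10] -/
theorem u0_pow_mem_PiIdx : M.ι (SemidirectProduct.inl (c 1 * c 2 : PuncturedSurfaceGroup 0 4)⁻¹ *
    SemidirectProduct.inr (Multiplicative.ofAdd (1 : ℤ))) ^ i ∈ M.PiIdx i := by
  rw [u0_pow_eq]
  exact Subgroup.mul_mem _ (M.PiG_le_PiIdx i (M.PiG.inv_mem (M.w_pow_mem_PiG i)))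
    (M.Tpow_le_PiIdx i (M.t0_pow_mem_Tpow i))

/-- `closure ⟨u₀^i⟩ ⊆ Π_I^{(i)}` (`Π_I^{(i)}` is closed). [cite: MochizukiAbsTopII2013, Def 1.2 (ii) p.10] -/
theorem Upow_le_PiIdx : M.Upow i ≤ M.PiIdx i :=
  Subgroup.topologicalClosure_minimal _ ((Subgroup.zpowers_le).mpr (M.u0_pow_mem_PiIdx i)) (M.isClosed_PiIdx i)

/-- The carrier of `Π_𝔾 ⊔ closure ⟨u₀^i⟩` is the product set, and it is closed. [cite: MochizukiAbsTopII2013, Def 1.2 (ii) p.10] -/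
theorem coe_PiG_sup_Upow : ((M.PiG ⊔ M.Upow i : Subgroup M.P) : Set M.P) = (M.PiG : Set M.P) * (M.Upow i : Set M.P) ∧
    IsClosed ((M.PiG ⊔ M.Upow i : Subgroup M.P) : Set M.P) := by
  haveI := M.normal_PiG
  have h : ((M.PiG ⊔ M.Upow i : Subgroup M.P) : Set M.P) = (M.PiG : Set M.P) * (M.Upow i : Set M.P) := by
    rw [Subgroup.normal_mul]
  exact ⟨h, h ▸ (M.isClosed_PiG.isCompact.mul (Subgroup.isClosed_topologicalClosure _).isCompact).isClosed⟩

/-- **`Π_I^{(i)} = Π_𝔾 · closure ⟨u₀^i⟩`** as well (`t₀^i = w^i u₀^i`). [cite: MochizukiAbsTopII2013, Def 1.2 (ii) p.10] -/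
theorem PiIdx_eq_PiG_sup_Upow : M.PiIdx i = M.PiG ⊔ M.Upow i := by
  refine le_antisymm (sup_le le_sup_left ?_) (sup_le (M.PiG_le_PiIdx i) (M.Upow_le_PiIdx i))
  refine Subgroup.topologicalClosure_minimal _ ((Subgroup.zpowers_le).mpr ?_) (M.coe_PiG_sup_Upow i).2
  rw [t0_pow_eq]
  exact Subgroup.mul_mem _ (Subgroup.mem_sup_left (M.w_pow_mem_PiG i)) (Subgroup.mem_sup_right (M.u0_pow_mem_Upow i))

/-- `closure ⟨u₀^i⟩ · Π_𝔾 = Π_I^{(i)}`. [cite: MochizukiAbsTopII2013, Prop 1.3 (iii) p.11] -/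
theorem Upow_sup_PiG : M.Upow i ⊔ M.PiG = M.PiIdx i := by rw [sup_comm, PiIdx_eq_PiG_sup_Upow]

/-- **`U ∩ Π_I^{(i)} = closure ⟨u₀^i⟩`** (`U ∩ Π_𝔾 = 1`). [cite: MochizukiAbsTopII2013, Prop 1.3 (iii) p.11] -/
theorem U_inf_PiIdx (hne : Sigma.Nonempty) (hprime : ∀ p ∈ Sigma, p.Prime) : M.U ⊓ M.PiIdx i = M.Upow i := by
  refine le_antisymm ?_ (le_inf (M.Upow_le_U i) (M.Upow_le_PiIdx i))
  rintro x ⟨hxU, hxI⟩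
  rw [PiIdx_eq_PiG_sup_Upow] at hxI
  have hx' : x ∈ ((M.PiG ⊔ M.Upow i : Subgroup M.P) : Set M.P) := hxI
  rw [(M.coe_PiG_sup_Upow i).1] at hx'
  obtain ⟨γ, hγ, u, hu, rfl⟩ := Set.mem_mul.mp hx'
  have hγU : γ ∈ M.U := by
    have h := M.U.mul_mem hxU (M.U.inv_mem (M.Upow_le_U i hu))
    rwa [mul_inv_cancel_right] at h
  have hγ1 : γ = 1 := by
    rw [← Subgroup.mem_bot, ← M.U_inf_PiG hne hprime]; exact ⟨hγU, hγ⟩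
  rw [hγ1, one_mul]; exact hu

variable (hne : Sigma.Nonempty) (hprime : ∀ p ∈ Sigma, p.Prime) (hi : IsSigmaInteger Sigma i)

/-- ★ **`I_{v_B} = closure ⟨u₀^i⟩`** at the index-`i` datum. [cite: MochizukiAbsTopII2013, Prop 1.3 (iii) p.11] -/
theorem Iv_one_dpscIdx : (M.dpscIdx hne hprime i hi).Iv ⟨(1 : Fin 2)⟩ = M.Upow i := by
  have h1 := M.Iv_dpscIdx i hne hprime hi ⟨(1 : Fin 2)⟩
  rw [M.Iv_eq_U hne hprime] at h1
  rw [h1]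
  exact M.U_inf_PiIdx i hne hprime

/-- The inertia sections of the index-`i` datum: `I_{v_A} = closure ⟨t₀^i⟩`, `I_{v_B} = closure ⟨u₀^i⟩`.
[cite: MochizukiAbsTopII2013, Prop 1.3 (iii) p.11] -/
theorem Iv_dpscIdx_eq (v : (M.dpscIdx hne hprime i hi).Vert) :
    (M.dpscIdx hne hprime i hi).Iv v = (![M.Tpow i, M.Upow i] : Fin 2 → Subgroup M.P) v.down := by
  rcases M.vert_cases_dpscIdx i hne hprime hi v with rfl | rfl
  · exact M.Iv_zero_dpscIdx i hne hprime hi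
  · exact M.Iv_one_dpscIdx i hne hprime hi

/-- «`I_v ↠ I`» at the index-`i` datum: `I_v · Π_𝔾 = Π_I^{(i)}` at both vertices. [cite: MochizukiAbsTopII2013, Prop 1.3 (iii) p.11] -/
theorem Iv_sup_PiG_dpscIdx (v : (M.dpscIdx hne hprime i hi).Vert) :
    (M.dpscIdx hne hprime i hi).Iv v ⊔ (M.dpscIdx hne hprime i hi).PiG = (M.dpscIdx hne hprime i hi).PiI := by
  rw [dpscIdx_PiG, dpscIdx_PiI, Iv_dpscIdx_eq]
  rcases M.vert_cases_dpscIdx i hne hprime hi v with rfl | rfl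
  · exact M.Tpow_sup_PiG i
  · exact M.Upow_sup_PiG i

/-- **`I_v ≅ Ẑ^Σ`** at both vertices of the index-`i` datum. [cite: MochizukiAbsTopII2013, Prop 1.3 (iii) p.11] -/
theorem isFreeProSigmaCyclic_Iv_dpscIdx (v : (M.dpscIdx hne hprime i hi).Vert) :
    IsFreeProSigmaCyclic (M.dpscIdx hne hprime i hi).Sigma ↥((M.dpscIdx hne hprime i hi).Iv v) := by
  rw [dpscIdx_Sigma, Iv_dpscIdx_eq]
  rcases M.vert_cases_dpscIdx i hne hprime hi v with rfl | rfl
  · exact M.isFreeProSigmaCyclic_Tpow i hi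
  · exact M.isFreeProSigmaCyclic_Upow i hne hprime hi

/-! ### Prop 1.3 (iii) first clause, (iii) rest, (i) at the index-`i` datum -/

/-- ★ **[AbsTopII] Prop 1.3 (iii), first clause (`DPSCData.Prop13iii`, F-0275: `I_v ∩ Π_𝔾 = 1`, `I_v · Π_𝔾 = Π_I`)
HOLDS at the index-`i` two-vertex datum, NO hypothesis.** [cite: MochizukiAbsTopII2013, Prop 1.3 (iii) p.11] -/
theorem prop13iii_dpscIdx :
    Literature.AnabelianGeometry.AbsoluteAnabelian.DPSCData.Prop13iii (M.dpscIdx hne hprime i hi).toDPSCData := by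
  haveI : CompactSpace ↥M.PiG := isCompact_iff_compactSpace.mp M.isClosed_PiG.isCompact
  exact DPSCData.prop13iii_ofEmbedding (M.pscDatum hne hprime) M.P M.PiG.subtype continuous_subtype_val
    Subtype.val_injective M.isClosed_range_subtype M.normal_range_subtype (M.PiIdx i) (M.normal_PiIdx i)
    (M.range_subtype_le_PiIdx i) (M.verticialEdgeLikeCommensurablyTerminal_pscDatum hne hprime)
    (M.isSlimGroup_vertGp_pscDatum hne hprime) (M.Iv_sup_PiG_dpscIdx i hne hprime hi)

/-- ★ **[AbsTopII] Prop 1.3 (iii) (rest) AS TYPED (`Prop_1_3_iii'`, F-0299) HOLDS at the index-`i` two-vertex datum,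
NO hypothesis** — `D_v ∩ Π_I = I_v × Π_v`, `I_v ≅ Ẑ^Σ`, the cusp clause (abc-iut-f-069's bridge).
[cite: MochizukiAbsTopII2013, Prop 1.3 (iii) p.11] -/
theorem prop_1_3_iii'_dpscIdx :
    Literature.AnabelianGeometry.AbsoluteAnabelian.AbsTopII.DPSCIndexData.Prop_1_3_iii' (M.dpscIdx hne hprime i hi) := by
  haveI : CompactSpace ↥M.PiG := isCompact_iff_compactSpace.mp M.isClosed_PiG.isCompact
  exact DPSCIndexData.prop_1_3_iii'_ofEmbedding (M.pscDatum hne hprime) M.P M.PiG.subtype continuous_subtype_val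
    Subtype.val_injective M.isClosed_range_subtype M.normal_range_subtype (M.PiIdx i) (M.normal_PiIdx i)
    (M.range_subtype_le_PiIdx i) (fun _ => i) (fun _ => hi) (M.verticialEdgeLikeCommensurablyTerminal_pscDatum hne hprime)
    (M.isSlimGroup_vertGp_pscDatum hne hprime) (M.Iv_sup_PiG_dpscIdx i hne hprime hi)
    (M.isFreeProSigmaCyclic_Iv_dpscIdx i hne hprime hi)

/-- ★ **[AbsTopII] Prop 1.3 (i) AS TYPED (`Prop_1_3_i`, F-0297) HOLDS at the index-`i` two-vertex datum, NO
hypothesis** (the cusp groups do not see `Π_I`). [cite: MochizukiAbsTopII2013, Prop 1.3 (i) p.11] -/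
theorem prop_1_3_i_dpscIdx :
    Literature.AnabelianGeometry.AbsoluteAnabelian.AbsTopII.DPSCIndexData.Prop_1_3_i (M.dpscIdx hne hprime i hi) := by
  haveI : CompactSpace ↥M.PiG := isCompact_iff_compactSpace.mp M.isClosed_PiG.isCompact
  have h04 : PuncturedSurfaceGroup.IsHyperbolicType 0 4 := by
    unfold PuncturedSurfaceGroup.IsHyperbolicType; norm_num
  exact DPSCIndexData.prop_1_3_i_ofEmbedding (M.pscDatum hne hprime) M.P M.PiG.subtype continuous_subtype_val
    Subtype.val_injective M.isClosed_range_subtype M.normal_range_subtype (M.PiIdx i) (M.normal_PiIdx i)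
    (M.range_subtype_le_PiIdx i) (fun _ => i) (fun _ => hi)
    (fun j => isFreeProSigmaCyclic_cuspInertia_closure h04 M.κG M.isProSigmaCompletion_κG j)

/-! ### The nodal inertia group `I_e = Π_e · closure ⟨t₀^i⟩` -/

/-- **`(Π_e · T) ∩ Π_I^{(i)} = Π_e · closure ⟨t₀^i⟩`** (`T ∩ Π_𝔾 = 1`). [cite: MochizukiAbsTopII2013, Prop 1.3 (ii) p.11] -/
theorem WT_inf_PiIdx : ((M.nodeGp).map M.PiG.subtype ⊔ M.T) ⊓ M.PiIdx i = (M.nodeGp).map M.PiG.subtype ⊔ M.Tpow i := by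
  refine le_antisymm ?_ (le_inf (sup_le_sup_left (M.Tpow_le_T i) _)
    (sup_le ((Subgroup.map_subtype_le _).trans (M.PiG_le_PiIdx i)) (M.Tpow_le_PiIdx i)))
  rintro x ⟨hxWT, hxI⟩
  obtain ⟨a, ha, t, ht, rfl⟩ := M.exists_mul_of_mem_sup M.T_le_centralizer_W hxWT
  obtain ⟨γ, hγ, k, hk, hγk⟩ := M.exists_eq_mul_of_mem_PiIdx i hxI
  -- `t k⁻¹ = a⁻¹ γ ∈ T ∩ Π_𝔾 = 1`
  have hT : t * k⁻¹ ∈ M.T := M.T.mul_mem ht (M.T.inv_mem (M.Tpow_le_T i hk))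
  have hG : t * k⁻¹ ∈ M.PiG := by
    have h : t * k⁻¹ = a⁻¹ * γ := by
      have ht' : t = a⁻¹ * (γ * k) := by rw [← hγk, inv_mul_cancel_left]
      rw [ht', ← mul_assoc, mul_inv_cancel_right]
    rw [h]; exact M.PiG.mul_mem (M.PiG.inv_mem (Subgroup.map_subtype_le _ ha)) hγ
  have htk : t = k := by
    rw [← mul_inv_eq_one, ← Subgroup.mem_bot, ← M.T_inf_PiG]; exact ⟨hT, hG⟩
  rw [htk]
  exact Subgroup.mul_mem _ (Subgroup.mem_sup_left ha) (Subgroup.mem_sup_right hk)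

/-- ★ **`I_e = Π_e · closure ⟨t₀^i⟩`** at the index-`i` datum. [cite: MochizukiAbsTopII2013, Prop 1.3 (ii) p.11] -/
theorem IvNode_dpscIdx_eq (e : (M.dpscIdx hne hprime i hi).Node) :
    (M.dpscIdx hne hprime i hi).IvNode e = (M.nodeGp).map M.PiG.subtype ⊔ M.Tpow i := by
  have h1 := M.IvNode_dpscIdx i hne hprime hi e
  rw [M.IvNode_eq_J hne hprime] at h1
  rw [h1]
  exact M.WT_inf_PiIdx i

/-- `closure ⟨t₀^i⟩` commutes with `Π_e`. [cite: MochizukiAbsTopII2013, Prop 1.3 (ii) p.11] -/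
theorem W_commute_Tpow : ∀ a ∈ (M.nodeGp).map M.PiG.subtype, ∀ k ∈ M.Tpow i, a * k = k * a :=
  fun a ha k hk => M.W_commute_T a ha k (M.Tpow_le_T i hk)

/-- **`I_e = Π_e × closure ⟨t₀^i⟩`** as an internal product (`Π_e ∩ T = 1`). [cite: MochizukiAbsTopII2013, Prop 1.3 (ii) p.11] -/
theorem isInternalProduct_W_Tpow :
    IsInternalProduct ((M.nodeGp).map M.PiG.subtype) (M.Tpow i) ((M.nodeGp).map M.PiG.subtype ⊔ M.Tpow i) := by
  refine ⟨le_sup_left, le_sup_right, M.W_commute_Tpow i, ?_, rfl⟩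
  rw [eq_bot_iff, ← M.isInternalProduct_WT.inf_eq_bot]
  exact inf_le_inf_left _ (M.Tpow_le_T i)

/-- `Π_e · closure ⟨t₀^i⟩` has carrier the product set and is closed. [cite: MochizukiAbsTopII2013, Prop 1.3 (ii) p.11] -/
theorem coe_W_sup_Tpow : (((M.nodeGp).map M.PiG.subtype ⊔ M.Tpow i : Subgroup M.P) : Set M.P) =
      ((M.nodeGp).map M.PiG.subtype : Set M.P) * (M.Tpow i : Set M.P) ∧
    IsClosed ((((M.nodeGp).map M.PiG.subtype ⊔ M.Tpow i : Subgroup M.P)) : Set M.P) :=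
  M.isClosed_sup_of_commute M.isClosed_W (Subgroup.isClosed_topologicalClosure _) (M.W_commute_Tpow i)

/-! ### Prop 1.3 (ii′), first two clauses, at the index-`i` datum -/

/-- **(ii′) clause 1 at the index-`i` datum: the exact sequence `1 → Π_e → I_e → I → 1`** (`Π_e ≤ I_e`,
`I_e ∩ Π_𝔾 = Π_e`, `I_e · Π_𝔾 = Π_I^{(i)}`), NO hypothesis. [cite: MochizukiAbsTopII2013, Prop 1.3 (ii) p.11] -/
theorem prop_1_3_ii'_exact_dpscIdx (e : (M.dpscIdx hne hprime i hi).Node) :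
    (M.dpscIdx hne hprime i hi).nodeSub e ≤ (M.dpscIdx hne hprime i hi).IvNode e ∧
      (M.dpscIdx hne hprime i hi).IvNode e ⊓ (M.dpscIdx hne hprime i hi).PiG = (M.dpscIdx hne hprime i hi).nodeSub e ∧
      (M.dpscIdx hne hprime i hi).IvNode e ⊔ (M.dpscIdx hne hprime i hi).PiG = (M.dpscIdx hne hprime i hi).PiI := by
  rw [IvNode_dpscIdx_eq, dpscIdx_PiG, dpscIdx_PiI, dpscIdx_nodeSub, nodeSub_eq]
  refine ⟨le_sup_left, ?_, ?_⟩
  · exact M.sup_inf_PiG_eq_of_section _ _ (Subgroup.map_subtype_le _)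
      (fun k hk => Subgroup.mem_centralizer_iff.mpr fun a ha => M.W_commute_Tpow i a ha k hk) (M.Tpow_inf_PiG i)
  · have h : (M.nodeGp).map M.PiG.subtype ⊔ M.Tpow i ⊔ M.PiG = M.PiIdx i := by
      rw [sup_assoc, M.Tpow_sup_PiG i, sup_eq_right]
      exact (Subgroup.map_subtype_le _).trans (M.PiG_le_PiIdx i)
    exact h

/-- **(ii′) clause 2 at the index-`i` datum: `I_e ≅ Ẑ^Σ × Ẑ^Σ`** — `I_e = Π_e × closure ⟨t₀^i⟩` with both factors closed
free pro-`Σ`-cyclic, NO hypothesis. [cite: MochizukiAbsTopII2013, Prop 1.3 (ii) p.11] -/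
theorem prop_1_3_ii'_product_dpscIdx (e : (M.dpscIdx hne hprime i hi).Node) :
    ∃ A B : Subgroup (M.dpscIdx hne hprime i hi).PiH,
      IsClosed (A : Set (M.dpscIdx hne hprime i hi).PiH) ∧ IsClosed (B : Set (M.dpscIdx hne hprime i hi).PiH) ∧
      IsFreeProSigmaCyclic (M.dpscIdx hne hprime i hi).Sigma A ∧ IsFreeProSigmaCyclic (M.dpscIdx hne hprime i hi).Sigma B ∧
      IsInternalProduct A B ((M.dpscIdx hne hprime i hi).IvNode e) := by
  rw [IvNode_dpscIdx_eq, dpscIdx_Sigma]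
  have hB : IsClosed ((M.Tpow i : Subgroup M.P) : Set M.P) := Subgroup.isClosed_topologicalClosure _
  exact ⟨(M.nodeGp).map M.PiG.subtype, M.Tpow i, M.isClosed_W, hB,
    M.isFreeProSigmaCyclic_W, M.isFreeProSigmaCyclic_Tpow i hi, M.isInternalProduct_W_Tpow i⟩

end Literature.AnabelianGeometry.AbsoluteAnabelian.AbsTopII.TwoTripodNodal.Model

end
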